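import Literature.Geometry.Manifold.QuotientManifold
import Literature.Geometry.Kaehler.RiemannSurfaceHolomorphicDifferentialRealPeriods
import Literature.NumberTheory.Automorphic.FuchsianEichlerShimuraWeightTwo
import HarnessLib

/-!
# Crux NUM `CartanOnePlaceDegreeLawAtThree` (item 24801), line `lattice` — the print clauses IX: HOLOMORPHIC DIFFERENTIALS ON `Γ∖ℍ` PULL BACK TO WEIGHT-TWO CUSP
# FORMS ON `Γ` (development `F = ∫ω` on the simply connected `ℍ`, `f = dF∕dz`); the pullback is additive, kills only `0` when `Γ∖ℍ` is compact, and its real periods are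
# the real periods of `ω`

Seat `bsd-stepL-tam3-p1` g29 (LEAD of crux 24801; `--supports stmt-BirchSwinnertonDyer-24801 --as helper`). Brick E3 of the LEAD's in-tree route to the SURJECTIVITY half of
(ESᶜ) `eichlerShimura_weightTwo_rePeriod` at `D > 1` (E1 `…TorsionFree`, E2 `…QuotientSurface`, E6 `…Descent`; this file + the dimension count close it): for a
torsion-free (free) properly discontinuous `Γ ≤ SL₂(ℝ)` without cusps and a holomorphic `1`-form `ω` on the Riemann surface `Γ∖ℍ` (Mathlib's orbit space with the
tree's `QuotientManifold.isManifold` structure), the tree's DEVELOPMENT `F : ℍ → ℂ` of `ω` along the projection (`MeromorphicOneForm.exists_isDevelopment`: `ℍ` is simply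
connected) is holomorphic with `F(γτ) = F(τ) + c(γ)`, so `f = dF∕dz` is a weight-two cusp form on `Γ` (`cuspFormOfDevelopment`; Mathlib `UpperHalfPlane.hasStrictDerivAt_smul`
for the chain rule), with `Re ∫_{z₀}^{γ z₀} f = Re (F(γ z₀) − F(z₀))` (`rePeriod_cuspFormOfDevelopment`), additive in `ω` (`cuspFormOfDevelopment_add`), and ZERO ONLY IF
`ω = 0` when `Γ∖ℍ` is compact (`eq_zero_of_cuspFormOfDevelopment_eq_zero`: `f = 0` ⇒ `F` constant ⇒ `Re F` is `Γ`-invariant ⇒ the tree's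
`IsDevelopment.eq_zero_of_forall_re_smul_eq`). Theorems + two definitions with bodies (`devDeriv`, `cuspFormOfDevelopment`); nothing about NUM or any curve is proved;
BSD is proved for no curve. [cite: FarkasKra1992, III.6.4 and III.3.4] [cite: ShimuraIATAF1971, §2.1 (automorphic forms of weight 2 = differentials) and Thm. 8.4 p. 234]
-/

set_option linter.dupNamespace false
set_option autoImplicit false

noncomputable section

open scoped MatrixGroups Manifold ContDiff Topology ModularForm
open Function Set Filter

namespace Summit.BirchSwinnertonDyer.BirchSwinnertonDyer.Theorems.CartanCover.PrintClauses

open Literature.NumberTheory.Automorphic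
open Literature.Geometry.Manifold
open Literature.Geometry.Kaehler Literature.Geometry.Kaehler.RiemannSurface

section Development

variable (Γ : Subgroup (GL (Fin 2) ℝ)) [Γ.HasDetOne] [ProperlyDiscontinuousSMul Γ UpperHalfPlane] [IsCancelSMul Γ UpperHalfPlane]

omit [ProperlyDiscontinuousSMul Γ UpperHalfPlane] [IsCancelSMul Γ UpperHalfPlane] in
/-- Elements of `Γ ≤ SL₂(ℝ)` have positive determinant. -/
private theorem det_pos' (γ : Γ) : 0 < (γ : GL (Fin 2) ℝ).val.det := by
  have h : (γ : GL (Fin 2) ℝ).det = 1 := Subgroup.HasDetOne.det_eq γ.2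
  have h2 : (γ : GL (Fin 2) ℝ).val.det = 1 := by
    rw [← Matrix.GeneralLinearGroup.val_det_apply, h, Units.val_one]
  rw [h2]; exact one_pos

omit [ProperlyDiscontinuousSMul Γ UpperHalfPlane] [IsCancelSMul Γ UpperHalfPlane] in
/-- Elements of `Γ` act holomorphically on `ℍ` (private twin of `…QuotientSurface.contMDiff_subgroup_smul`, whose olean this file does not import). -/
private theorem contMDiff_smul' (γ : Γ) : ContMDiff 𝓘(ℂ) 𝓘(ℂ) ω (fun τ : UpperHalfPlane => γ • τ) := by
  have hdet : 0 < (γ : GL (Fin 2) ℝ).det.val := by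
    rw [Subgroup.HasDetOne.det_eq γ.2, Units.val_one]; exact one_pos
  exact UpperHalfPlane.contMDiff_smul hdet

/-- `Γ∖ℍ` is a complex manifold (tree `QuotientManifold.isManifold`; twin of `…QuotientSurface.isManifold_orbitQuotient`). [cite: FarkasKra1992, IV.5] -/
private theorem isManifold' : IsManifold 𝓘(ℂ) ω (MulAction.orbitRel.Quotient Γ UpperHalfPlane) :=
  QuotientManifold.isManifold (contMDiff_smul' Γ)

attribute [local instance] isManifold'

/-- The projection `ℍ → Γ∖ℍ`. -/
abbrev proj : UpperHalfPlane → MulAction.orbitRel.Quotient Γ UpperHalfPlane := Quotient.mk _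

omit [Γ.HasDetOne] [ProperlyDiscontinuousSMul Γ UpperHalfPlane] [IsCancelSMul Γ UpperHalfPlane] in
/-- The projection is continuous. -/
theorem continuous_proj : Continuous (proj Γ) := continuous_quot_mk

omit [Γ.HasDetOne] [ProperlyDiscontinuousSMul Γ UpperHalfPlane] [IsCancelSMul Γ UpperHalfPlane] in
/-- The projection is `Γ`-invariant. -/
theorem proj_smul (γ : Γ) (τ : UpperHalfPlane) : proj Γ (γ • τ) = proj Γ τ := Quotient.sound ⟨γ, rfl⟩

omit [Γ.HasDetOne] in
/-- The projection is a quotient covering map with deck group `Γ` (Mathlib). -/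
theorem isQuotientCoveringMap_proj : IsQuotientCoveringMap (proj Γ) Γ := isQuotientCoveringMap_quotientMk_of_properlyDiscontinuousSMul

/-- The projection is holomorphic (tree `QuotientManifold.contMDiff_mk`). -/
theorem contMDiff_proj : ContMDiff 𝓘(ℂ) 𝓘(ℂ) ω (proj Γ) := QuotientManifold.contMDiff_mk (contMDiff_smul' Γ)

variable {Γ}
variable {θ θ₁ θ₂ : MeromorphicOneForm (MulAction.orbitRel.Quotient Γ UpperHalfPlane)} {F F₁ F₂ : UpperHalfPlane → ℂ}

/-- **Every holomorphic `1`-form on `Γ∖ℍ` has a development on `ℍ`** (`ℍ` is simply connected and locally path connected; tree `exists_isDevelopment`), normalised by `F(I) = 0`.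
[cite: FarkasKra1992, III.6.4] -/
theorem exists_isDevelopment_proj (hθ : θ.IsHolomorphic) : ∃ F : UpperHalfPlane → ℂ, θ.IsDevelopment (proj Γ) F ∧ F UpperHalfPlane.I = 0 :=
  MeromorphicOneForm.exists_isDevelopment hθ (continuous_proj Γ) UpperHalfPlane.I

/-- **A development on `ℍ` is holomorphic** (locally `G ∘ proj` with `G` complex-differentiable and `proj` holomorphic). [cite: FarkasKra1992, III.6.4] -/
theorem mdifferentiable_of_isDevelopment (hF : θ.IsDevelopment (proj Γ) F) : MDifferentiable 𝓘(ℂ) 𝓘(ℂ) F := by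
  intro a
  obtain ⟨G, hG, hFG⟩ := hF.exists_mdifferentiableAt (a := a)
  have h1 : MDifferentiableAt 𝓘(ℂ) 𝓘(ℂ) (G ∘ proj Γ) a := hG.comp a ((contMDiff_proj Γ a).mdifferentiableAt (by simp))
  exact h1.congr_of_eventuallyEq hFG

/-- In the coordinate of `ℍ ⊆ ℂ`: `F ∘ ofComplex` is complex-differentiable on the upper half-plane. -/
theorem differentiableOn_of_isDevelopment (hF : θ.IsDevelopment (proj Γ) F) :
    DifferentiableOn ℂ (F ∘ UpperHalfPlane.ofComplex) {z : ℂ | 0 < z.im} :=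
  UpperHalfPlane.mdifferentiable_iff.mp (mdifferentiable_of_isDevelopment hF)

/-- **`dF∕dz`**: the derivative of a function on `ℍ` in the coordinate of `ℍ ⊆ ℂ`. -/
def devDeriv (F : UpperHalfPlane → ℂ) : UpperHalfPlane → ℂ := fun τ => deriv (F ∘ UpperHalfPlane.ofComplex) τ

/-- `F ∘ ofComplex` has derivative `devDeriv F` on the upper half-plane. -/
theorem hasDerivAt_of_isDevelopment (hF : θ.IsDevelopment (proj Γ) F) {z : ℂ} (hz : 0 < z.im) :
    HasDerivAt (F ∘ UpperHalfPlane.ofComplex) (devDeriv F (UpperHalfPlane.ofComplex z)) z := by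
  have hd : DifferentiableAt ℂ (F ∘ UpperHalfPlane.ofComplex) z :=
    (differentiableOn_of_isDevelopment hF z hz).differentiableAt (UpperHalfPlane.isOpen_upperHalfPlaneSet.mem_nhds hz)
  have h := hd.hasDerivAt
  rwa [devDeriv, UpperHalfPlane.ofComplex_apply_of_im_pos hz]

/-- `devDeriv F ∘ ofComplex = deriv (F ∘ ofComplex)` on the upper half-plane. -/
theorem devDeriv_comp_ofComplex {F : UpperHalfPlane → ℂ} {z : ℂ} (hz : 0 < z.im) :
    devDeriv F (UpperHalfPlane.ofComplex z) = deriv (F ∘ UpperHalfPlane.ofComplex) z := by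
  rw [devDeriv, UpperHalfPlane.ofComplex_apply_of_im_pos hz]

/-- **`devDeriv F` is holomorphic** (derivative of a holomorphic function on an open set). -/
theorem mdifferentiable_devDeriv (hF : θ.IsDevelopment (proj Γ) F) : MDifferentiable 𝓘(ℂ) 𝓘(ℂ) (devDeriv F) := by
  rw [UpperHalfPlane.mdifferentiable_iff]
  have h1 : DifferentiableOn ℂ (deriv (F ∘ UpperHalfPlane.ofComplex)) {z : ℂ | 0 < z.im} :=
    ((differentiableOn_of_isDevelopment hF).analyticOnNhd UpperHalfPlane.isOpen_upperHalfPlaneSet).deriv.differentiableOn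
  refine h1.congr fun z hz => ?_
  exact devDeriv_comp_ofComplex hz

omit [Γ.HasDetOne] in
/-- **The periods of a development**: `F (γ τ) = F τ + c(γ)` for every `γ ∈ Γ`. [cite: FarkasKra1992, III.6.4] -/
theorem exists_apply_smul_eq_add (hF : θ.IsDevelopment (proj Γ) F) (γ : Γ) : ∃ c : ℂ, ∀ τ : UpperHalfPlane, F (γ • τ) = F τ + c :=
  hF.exists_comp_eq_add_const (continuous_proj Γ) (τ := fun τ => γ • τ) (continuous_const_smul γ) (proj_smul Γ γ)

/-- **`devDeriv F` is `Γ`-invariant of weight two**: differentiating `F(γz) = F(z) + c` with `d(γz)/dz = 1/(cz+d)²`. [cite: ShimuraIATAF1971, §2.1] -/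
theorem devDeriv_slash (hF : θ.IsDevelopment (proj Γ) F) (γ : Γ) :
    (devDeriv F) ∣[(2 : ℤ)] (γ : GL (Fin 2) ℝ) = devDeriv F := by
  obtain ⟨c, hc⟩ := exists_apply_smul_eq_add hF γ
  funext τ
  have hdet := det_pos' Γ γ
  have hdet' : 0 < (γ : GL (Fin 2) ℝ).det.val := by
    rw [Subgroup.HasDetOne.det_eq γ.2, Units.val_one]; exact one_pos
  rw [ModularForm.slash_apply]
  -- `σ γ = id`, `|det γ| = 1`
  have hσ : ∀ w : ℂ, UpperHalfPlane.σ (γ : GL (Fin 2) ℝ) w = w := fun w => by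
    rw [UpperHalfPlane.σ, if_pos hdet']; rfl
  have habs : |(γ : GL (Fin 2) ℝ).det.val| = 1 := by rw [Subgroup.HasDetOne.det_eq γ.2, Units.val_one, abs_one]
  rw [hσ, habs]
  simp only [Complex.ofReal_one, one_zpow, mul_one]
  -- chain rule at `τ`
  have hτ : 0 < (τ : ℂ).im := τ.im_pos
  have hγτ : 0 < (((γ : GL (Fin 2) ℝ) • τ : UpperHalfPlane) : ℂ).im := ((γ : GL (Fin 2) ℝ) • τ).im_pos
  have h1 : HasDerivAt (fun z : ℂ => (((γ : GL (Fin 2) ℝ) • UpperHalfPlane.ofComplex z : UpperHalfPlane) : ℂ))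
      ((γ : GL (Fin 2) ℝ).val.det / UpperHalfPlane.denom (γ : GL (Fin 2) ℝ) τ ^ 2) τ := (UpperHalfPlane.hasStrictDerivAt_smul hdet τ).hasDerivAt
  have h2 : HasDerivAt (F ∘ UpperHalfPlane.ofComplex) (devDeriv F ((γ : GL (Fin 2) ℝ) • τ))
      ((fun z : ℂ => (((γ : GL (Fin 2) ℝ) • UpperHalfPlane.ofComplex z : UpperHalfPlane) : ℂ)) (τ : ℂ)) := by
    have h := hasDerivAt_of_isDevelopment hF hγτ
    rw [UpperHalfPlane.ofComplex_apply] at h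
    simp only [UpperHalfPlane.ofComplex_apply]
    exact h
  have h3 : HasDerivAt ((F ∘ UpperHalfPlane.ofComplex) ∘ fun z : ℂ => (((γ : GL (Fin 2) ℝ) • UpperHalfPlane.ofComplex z : UpperHalfPlane) : ℂ))
      (devDeriv F ((γ : GL (Fin 2) ℝ) • τ) * ((γ : GL (Fin 2) ℝ).val.det / UpperHalfPlane.denom (γ : GL (Fin 2) ℝ) τ ^ 2)) τ :=
    h2.comp (τ : ℂ) h1
  -- the same function is `z ↦ F (ofComplex z) + c` near `τ`
  have h4 : HasDerivAt ((F ∘ UpperHalfPlane.ofComplex) ∘ fun z : ℂ => (((γ : GL (Fin 2) ℝ) • UpperHalfPlane.ofComplex z : UpperHalfPlane) : ℂ))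
      (devDeriv F τ) τ := by
    have h5 : HasDerivAt (fun z : ℂ => (F ∘ UpperHalfPlane.ofComplex) z + c) (devDeriv F τ) τ := by
      have h := (hasDerivAt_of_isDevelopment hF hτ).add_const c
      rwa [UpperHalfPlane.ofComplex_apply] at h
    refine h5.congr_of_eventuallyEq ?_
    filter_upwards [UpperHalfPlane.isOpen_upperHalfPlaneSet.mem_nhds hτ] with z hz
    simp only [comp_apply, UpperHalfPlane.ofComplex_apply, UpperHalfPlane.ofComplex_apply_of_im_pos hz]
    have := hc ⟨z, hz⟩
    exact this
  have h6 := h3.unique h4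
  -- `denom ^ (-2) * (det / denom^2)⁻¹`-bookkeeping
  have hden : UpperHalfPlane.denom (γ : GL (Fin 2) ℝ) τ ≠ 0 := UpperHalfPlane.denom_ne_zero _ _
  have hdet1 : ((γ : GL (Fin 2) ℝ).val.det : ℂ) = 1 := by
    have : (γ : GL (Fin 2) ℝ).val.det = 1 := by rw [← Matrix.GeneralLinearGroup.val_det_apply, Subgroup.HasDetOne.det_eq γ.2, Units.val_one]
    rw [this, Complex.ofReal_one]
  rw [hdet1] at h6
  rw [← h6, zpow_neg, zpow_two]
  field_simp

/-- **THE PULLBACK CUSP FORM `f = dF∕dz`** of a holomorphic differential on `Γ∖ℍ` (for `Γ` WITHOUT CUSPS, e.g. cocompact): weight two, holomorphic, `Γ`-invariant.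
[cite: ShimuraIATAF1971, §2.1 and Thm. 8.4] [cite: FarkasKra1992, III.6.4] -/
def cuspFormOfDevelopment (hcusp : ∀ c : OnePoint ℝ, ¬ IsCusp c Γ) (hF : θ.IsDevelopment (proj Γ) F) : CuspForm Γ 2 where
  toFun := devDeriv F
  slash_action_eq' := fun γ hγ => devDeriv_slash hF ⟨γ, hγ⟩
  holo' := mdifferentiable_devDeriv hF
  zero_at_cusps' := fun hc => absurd hc (hcusp _)

/-- The pullback form as a function. -/
@[simp] theorem coe_cuspFormOfDevelopment (hcusp : ∀ c : OnePoint ℝ, ¬ IsCusp c Γ) (hF : θ.IsDevelopment (proj Γ) F) :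
    ⇑(cuspFormOfDevelopment hcusp hF) = devDeriv F := rfl

/-- **Real periods of the pullback are the real periods of `ω`**: `Re ∫_{z₀}^{γ z₀} f = Re (F(γ z₀) − F(z₀))` (FTC along the segment, tree `segmentIntegral_eq_sub`).
[cite: ShimuraIATAF1971, §8.2 (8.2.19)–(8.2.20)] [cite: FarkasKra1992, III.6.4] -/
theorem rePeriod_cuspFormOfDevelopment (hcusp : ∀ c : OnePoint ℝ, ¬ IsCusp c Γ) (hF : θ.IsDevelopment (proj Γ) F) (z₀ : UpperHalfPlane) (γ : Γ) :
    CuspForm.rePeriod (cuspFormOfDevelopment hcusp hF) z₀ γ = (F (γ • z₀) - F z₀).re := by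
  rw [CuspForm.rePeriod_apply,
    segmentIntegral_eq_sub (cuspFormOfDevelopment hcusp hF) (g := F ∘ UpperHalfPlane.ofComplex) (fun z hz => hasDerivAt_of_isDevelopment hF hz) z₀ _]
  simp only [comp_apply, UpperHalfPlane.ofComplex_apply]
  rfl

/-- The complex period likewise: `∫_{z₀}^{γ z₀} f = F(γ z₀) − F(z₀)`. [cite: FarkasKra1992, III.6.4] -/
theorem period_cuspFormOfDevelopment (hcusp : ∀ c : OnePoint ℝ, ¬ IsCusp c Γ) (hF : θ.IsDevelopment (proj Γ) F) (z₀ : UpperHalfPlane) (γ : Γ) :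
    CuspForm.period (cuspFormOfDevelopment hcusp hF) z₀ γ = F (γ • z₀) - F z₀ := by
  rw [CuspForm.period_apply,
    segmentIntegral_eq_sub (cuspFormOfDevelopment hcusp hF) (g := F ∘ UpperHalfPlane.ofComplex) (fun z hz => hasDerivAt_of_isDevelopment hF hz) z₀ _]
  simp only [comp_apply, UpperHalfPlane.ofComplex_apply]
  rfl

/-- **Additivity**: the pullback of `ω₁ + ω₂` along `F₁ + F₂` is the sum of the pullbacks. [cite: FarkasKra1992, III.6.4] -/
theorem devDeriv_add (hF₁ : θ₁.IsDevelopment (proj Γ) F₁) (hF₂ : θ₂.IsDevelopment (proj Γ) F₂) :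
    devDeriv (fun τ => F₁ τ + F₂ τ) = fun τ => devDeriv F₁ τ + devDeriv F₂ τ := by
  funext τ
  have h := ((hasDerivAt_of_isDevelopment hF₁ τ.im_pos).add (hasDerivAt_of_isDevelopment hF₂ τ.im_pos)).deriv
  rw [UpperHalfPlane.ofComplex_apply] at h
  rw [devDeriv, ← h]
  rfl

/-- **Homogeneity**: the pullback of `c • ω` along `c F` is `c` times the pullback. [cite: FarkasKra1992, III.6.4] -/
theorem devDeriv_const_mul (hF : θ.IsDevelopment (proj Γ) F) (c : ℂ) :
    devDeriv (fun τ => c * F τ) = fun τ => c * devDeriv F τ := by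
  funext τ
  have h := ((hasDerivAt_of_isDevelopment hF τ.im_pos).const_mul c).deriv
  rw [UpperHalfPlane.ofComplex_apply] at h
  rw [devDeriv, ← h]
  rfl

/-- **Injectivity of the pullback when `Γ∖ℍ` is compact**: if `dF∕dz = 0` then `ω = 0` (`F` is constant on the connected `ℍ`, so `Re F` is `Γ`-invariant and the tree's
maximum-principle lemma `IsDevelopment.eq_zero_of_forall_re_smul_eq` applies). [cite: FarkasKra1992, III.3.3 and III.2] -/
theorem eq_zero_of_devDeriv_eq_zero [CompactSpace (MulAction.orbitRel.Quotient Γ UpperHalfPlane)] (hθ : θ.IsHolomorphic)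
    (hF : θ.IsDevelopment (proj Γ) F) (h0 : devDeriv F = 0) : θ = 0 := by
  haveI : PreconnectedSpace (MulAction.orbitRel.Quotient Γ UpperHalfPlane) := Quotient.instConnectedSpace.toPreconnectedSpace
  -- `F ∘ ofComplex` has zero derivative on the connected open upper half-plane, so `F` is constant
  have hconst : ∀ τ τ' : UpperHalfPlane, F τ = F τ' := by
    intro τ τ'
    have h := UpperHalfPlane.isOpen_upperHalfPlaneSet.is_const_of_deriv_eq_zero (convex_halfSpace_im_gt 0).isPreconnected
      (differentiableOn_of_isDevelopment hF) (fun z hz => by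
        have h1 := (hasDerivAt_of_isDevelopment hF hz).deriv
        rw [h1, h0]; rfl) τ.im_pos τ'.im_pos
    simpa [comp_apply, UpperHalfPlane.ofComplex_apply] using h
  exact hF.eq_zero_of_forall_re_smul_eq (isQuotientCoveringMap_proj Γ) hθ fun γ a => by rw [hconst (γ • a) a]

/-- **Injectivity, cusp-form version**: for cocompact `Γ` without cusps, `cuspFormOfDevelopment ω = 0 ⇒ ω = 0`. [cite: ShimuraIATAF1971, Thm. 8.4] -/
theorem eq_zero_of_cuspFormOfDevelopment_eq_zero [CompactSpace (MulAction.orbitRel.Quotient Γ UpperHalfPlane)] (hcusp : ∀ c : OnePoint ℝ, ¬ IsCusp c Γ)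
    (hθ : θ.IsHolomorphic) (hF : θ.IsDevelopment (proj Γ) F) (h0 : cuspFormOfDevelopment hcusp hF = 0) : θ = 0 := by
  refine eq_zero_of_devDeriv_eq_zero hθ hF ?_
  have h := congrArg (fun G : CuspForm Γ 2 => (⇑G : UpperHalfPlane → ℂ)) h0
  simpa using h

end Development

end Summit.BirchSwinnertonDyer.BirchSwinnertonDyer.Theorems.CartanCover.PrintClauses

end
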